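import Summits.QuantumFields.YangMills.Theorems.OneCertifiedCubeCrossoverCertificateDefs

/-!
# Route `OneCertifiedCube`, crux `CrossoverCertificate` (stmt-QuantumFields-16125): openness glue and the
# `limsup` / `liminf` form of the crux and of the two legs of line `registered`

Support file for the crux item (lead `prover-line-stmt-QuantumFields-16125-0`, skeleton
`Cruxes/CrossoverCertificate/Lines/birth.lean`).  Over the influence functional `Θ = influence` of
`OneCertifiedCubeCrossoverCertificateDefs.lean` (p146591) it records, sorry-free:

* the STATEMENTS of the two registered stubs `stub_influenceConverges` (UV leg) and `stub_limitCertificate` (value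
  leg) appear below only spelled out in hypothesis position or inside an `Iff` (nothing is asserted about them);
* `eventually_influence_le_of_tendsto_of_frequently` — OPENNESS: if `Θ_k` converges and is frequently `≤ θ` with
  `θ·M(n) < 1` then some `ε ≥ 0` with `ε·M(n) < 1` bounds `Θ_k` eventually (`ε := max 0 ((θ + 1/M)/2)`);
* `crossoverCertificate_of_influenceConverges_of_limitCertificate` — the line's composition in hypothesis form
  (UV leg → value leg → crux), and `limitCertificate_of_crossoverCertificate` — the value leg is IMPLIED by the crux;
* `crossoverCertificate_iff_limsup` — the crux says `limsup_k Θ_k(ℓ, n) < 1/M(n)` at one physical scale `(ℓ, n)`;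
  `limitCertificate_iff_liminf` — the value leg says `liminf_k Θ_k(ℓ, n) < 1/M(n)` at one scale; and
  `liminf_eq_limsup_of_tendsto_influence` — under the UV leg the two coincide scale by scale.

So the cut of line `registered` is EXACTLY `limsup < c ⇐ (lim exists) ∧ (liminf < c)` for the `[0,2]`-valued
sequence `Θ_k(ℓ, n)`; in particular the value leg differs from the crux only by `liminf` versus `limsup` of the same
bounded sequence (the lead's census uses this to class `stub_limitCertificate` as crux-sized).  Everything here is
pointwise in `(G, r, sch, T)` and transposes verbatim to an existential-in-the-scheme restatement of the crux.

References: route file `Theses/OneCertifiedCube.lean`; Dobrushin–Shlosman (1985) (finite-size conditions);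
Mathlib `Filter.limsup` / `Filter.liminf` API (`limsup_le_of_le`, `eventually_lt_of_limsup_lt`,
`liminf_le_of_frequently_le`, `frequently_lt_of_liminf_lt`).
-/

set_option autoImplicit false

noncomputable section

namespace Summit.QuantumFields.YangMills.Cruxes.CrossoverCertificate.Birth

open MeasureTheory Filter Topology
open Literature.MathematicalPhysics.QuantumFieldTheory
open Literature.MathematicalPhysics.QuantumLattice

variable {G : Type} [Group G] [TopologicalSpace G] [IsTopologicalGroup G] [CompactSpace G]
  [MeasurableSpace G] [BorelSpace G]


/-- `M(n) = (4n+3)⁴ − (4n+1)⁴ > 0` (as a real number, through the `ℕ`-subtraction of the crux). [folklore] -/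
theorem shellCount_pos (n : ℕ) : (0 : ℝ) < ((((4 * n + 3) ^ 4 - (4 * n + 1) ^ 4 : ℕ)) : ℝ) := by
  have h : (4 * n + 1) ^ 4 < (4 * n + 3) ^ 4 := Nat.pow_lt_pow_left (by omega) (by norm_num)
  exact_mod_cast Nat.sub_pos_of_lt h

/-- The influence sequence along any couplings/cell sizes is bounded above by `2` (for `limsup` bookkeeping). [folklore] -/
theorem isBoundedUnder_le_influence {N : ℕ} (ρ : G →* Matrix (Fin N) (Fin N) ℂ) (βs : ℕ → ℝ) (bs : ℕ → ℕ)
    (n : ℕ) : IsBoundedUnder (· ≤ ·) atTop (fun k : ℕ => influence (G := G) ρ (βs k) (bs k) n) :=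
  isBoundedUnder_of ⟨2, fun k => influence_le_two ρ (βs k) (bs k) n⟩

/-- The influence sequence is bounded below by `0` (for `liminf` bookkeeping). [folklore] -/
theorem isBoundedUnder_ge_influence {N : ℕ} (ρ : G →* Matrix (Fin N) (Fin N) ℂ) (βs : ℕ → ℝ) (bs : ℕ → ℕ)
    (n : ℕ) : IsBoundedUnder (· ≥ ·) atTop (fun k : ℕ => influence (G := G) ρ (βs k) (bs k) n) :=
  isBoundedUnder_of ⟨0, fun k => influence_nonneg ρ (βs k) (bs k) n⟩

/-- **Openness — the glue.** If along some sequence of couplings `βs` and cell sizes `bs` the influence functional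
CONVERGES (to `θ'`) and is FREQUENTLY below a margin `θ` with `θ · M(n) < 1`, then there is `ε ≥ 0` with
`ε · M(n) < 1` and `Θ_k ≤ ε` for all large `k`: `θ' ≤ θ` (closed half-line), `ε := max 0 ((θ + 1/M)/2)`. [folklore] -/
theorem eventually_influence_le_of_tendsto_of_frequently {N : ℕ} (ρ : G →* Matrix (Fin N) (Fin N) ℂ)
    (βs : ℕ → ℝ) (bs : ℕ → ℕ) (n : ℕ) {θ θ' : ℝ}
    (hlim : Tendsto (fun k : ℕ => influence (G := G) ρ (βs k) (bs k) n) atTop (𝓝 θ'))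
    (hfreq : ∃ᶠ k : ℕ in atTop, influence (G := G) ρ (βs k) (bs k) n ≤ θ)
    (hθ : θ * ((((4 * n + 3) ^ 4 - (4 * n + 1) ^ 4 : ℕ)) : ℝ) < 1) :
    ∃ ε : ℝ, 0 ≤ ε ∧ ε * ((((4 * n + 3) ^ 4 - (4 * n + 1) ^ 4 : ℕ)) : ℝ) < 1 ∧
      ∀ᶠ k : ℕ in atTop, influence (G := G) ρ (βs k) (bs k) n ≤ ε := by
  have hle : θ' ≤ θ := isClosed_Iic.mem_of_frequently_of_tendsto hfreq hlim
  set M : ℝ := ((((4 * n + 3) ^ 4 - (4 * n + 1) ^ 4 : ℕ)) : ℝ) with hMdef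
  have hM : 0 < M := shellCount_pos n
  set ε : ℝ := max 0 ((θ + 1 / M) / 2) with hεdef
  have hε0 : 0 ≤ ε := le_max_left _ _
  have hθε : θ < ε := by
    have : θ < (θ + 1 / M) / 2 := by
      have : θ < 1 / M := by rw [lt_div_iff₀ hM]; exact hθ
      linarith
    exact this.trans_le (le_max_right _ _)
  have hεM : ε * M < 1 := by
    rcases le_total 0 ((θ + 1 / M) / 2) with h | h
    · rw [hεdef, max_eq_right h]
      have : (θ + 1 / M) / 2 * M = (θ * M + 1) / 2 := by field_simp
      rw [this]; linarith
    · rw [hεdef, max_eq_left h]; simp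
  refine ⟨ε, hε0, hεM, ?_⟩
  have hev : ∀ᶠ k : ℕ in atTop, influence (G := G) ρ (βs k) (bs k) n < ε :=
    hlim.eventually (Iio_mem_nhds (hle.trans_lt hθε))
  filter_upwards [hev] with k hk using hk.le

/-- **Reduction (the line's composition, hypothesis form).** The UV leg and the value leg together give the crux:
the certified scale `(ℓ, n, θ)` and the frequent certificate from the value leg (`stub_limitCertificate`'s
statement, hypothesis `h₂`), the limit at that scale from the UV leg (`stub_influenceConverges`'s statement,
hypothesis `h₁`), then openness and the bridge `crossoverCertificate_iff`. [folklore] -/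
theorem crossoverCertificate_of_influenceConverges_of_limitCertificate
    (h₁ : ∀ (G : Type) [Group G] [TopologicalSpace G] [IsTopologicalGroup G] [CompactSpace G] [MeasurableSpace G]
        [BorelSpace G], IsCompactSimpleLieGroup G → ∀ (r : LatticeRep G) (sch : SpeciesScheme (YMSpecies G))
        (T : OSData (YMSpecies G) 4), sch.HasWeakCouplingLimit → IsYangMillsFor r sch T →
        T.IsNontrivial r.curvature → T.IsNonGaussian r.curvature →
        ∀ ℓ : ℝ, 0 < ℓ → ∀ n : ℕ, 1 ≤ n →
          ∃ θ : ℝ, Tendsto (fun k : ℕ => influence r.ρ (sch.β k) ⌈ℓ / sch.a k⌉₊ n) atTop (𝓝 θ))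
    (h₂ : ∀ (G : Type) [Group G] [TopologicalSpace G] [IsTopologicalGroup G] [CompactSpace G] [MeasurableSpace G]
        [BorelSpace G], IsCompactSimpleLieGroup G → ∀ (r : LatticeRep G) (sch : SpeciesScheme (YMSpecies G))
        (T : OSData (YMSpecies G) 4), sch.HasWeakCouplingLimit → IsYangMillsFor r sch T →
        T.IsNontrivial r.curvature → T.IsNonGaussian r.curvature →
        ∃ ℓ : ℝ, 0 < ℓ ∧ ∃ (n : ℕ) (θ : ℝ), 1 ≤ n ∧ θ * ((((4 * n + 3) ^ 4 - (4 * n + 1) ^ 4 : ℕ)) : ℝ) < 1 ∧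
          ∃ᶠ k : ℕ in atTop, influence r.ρ (sch.β k) ⌈ℓ / sch.a k⌉₊ n ≤ θ) :
    Summit.QuantumFields.YangMills.Theses.OneCertifiedCube.CrossoverCertificate := by
  rw [crossoverCertificate_iff]
  intro G _ _ _ _ _ _ hG r sch T hW hYM hNT hNG
  obtain ⟨ℓ, hℓ, n, θ, hn, hθ, hfreq⟩ := h₂ G hG r sch T hW hYM hNT hNG
  obtain ⟨θ', hlim⟩ := h₁ G hG r sch T hW hYM hNT hNG ℓ hℓ n hn
  obtain ⟨ε, hε0, hεM, hev⟩ :=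
    eventually_influence_le_of_tendsto_of_frequently r.ρ sch.β (fun k => ⌈ℓ / sch.a k⌉₊) n hlim hfreq hθ
  exact ⟨ℓ, hℓ, n, ε, hn, hε0, hεM, hev⟩

/-- **The value leg is implied by the crux** (eventually ⇒ frequently, with `θ := ε`): the cut removes from the crux
exactly the upgrade frequently ⇒ eventually. [folklore] -/
theorem limitCertificate_of_crossoverCertificate
    (h : Summit.QuantumFields.YangMills.Theses.OneCertifiedCube.CrossoverCertificate) :
    ∀ (G : Type) [Group G] [TopologicalSpace G] [IsTopologicalGroup G] [CompactSpace G] [MeasurableSpace G]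
        [BorelSpace G], IsCompactSimpleLieGroup G → ∀ (r : LatticeRep G) (sch : SpeciesScheme (YMSpecies G))
        (T : OSData (YMSpecies G) 4), sch.HasWeakCouplingLimit → IsYangMillsFor r sch T →
        T.IsNontrivial r.curvature → T.IsNonGaussian r.curvature →
        ∃ ℓ : ℝ, 0 < ℓ ∧ ∃ (n : ℕ) (θ : ℝ), 1 ≤ n ∧ θ * ((((4 * n + 3) ^ 4 - (4 * n + 1) ^ 4 : ℕ)) : ℝ) < 1 ∧
          ∃ᶠ k : ℕ in atTop, influence r.ρ (sch.β k) ⌈ℓ / sch.a k⌉₊ n ≤ θ := by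
  rw [crossoverCertificate_iff] at h
  intro G _ _ _ _ _ _ hG r sch T hW hYM hNT hNG
  obtain ⟨ℓ, hℓ, n, ε, hn, -, hεM, hev⟩ := h G hG r sch T hW hYM hNT hNG
  exact ⟨ℓ, hℓ, n, ε, hn, hεM, hev.frequently⟩

/-- **The crux is a `limsup` statement**: along every admissible scheme there is one physical scale `(ℓ, n)` with
`limsup_k Θ(r.ρ, β_k, ⌈ℓ/a_k⌉₊, n) < 1/M(n)`.  (`→`: `limsup ≤ ε < 1/M`; `←`: any `ε` strictly between the
`limsup` and `1/M`, made nonnegative, bounds `Θ_k` eventually.) [folklore] -/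
theorem crossoverCertificate_iff_limsup :
    Summit.QuantumFields.YangMills.Theses.OneCertifiedCube.CrossoverCertificate ↔
      ∀ (G : Type) [Group G] [TopologicalSpace G] [IsTopologicalGroup G] [CompactSpace G] [MeasurableSpace G]
        [BorelSpace G], IsCompactSimpleLieGroup G → ∀ (r : LatticeRep G) (sch : SpeciesScheme (YMSpecies G))
        (T : OSData (YMSpecies G) 4), sch.HasWeakCouplingLimit → IsYangMillsFor r sch T →
        T.IsNontrivial r.curvature → T.IsNonGaussian r.curvature →
        ∃ ℓ : ℝ, 0 < ℓ ∧ ∃ n : ℕ, 1 ≤ n ∧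
          limsup (fun k : ℕ => influence r.ρ (sch.β k) ⌈ℓ / sch.a k⌉₊ n) atTop <
            1 / ((((4 * n + 3) ^ 4 - (4 * n + 1) ^ 4 : ℕ)) : ℝ) := by
  rw [crossoverCertificate_iff]
  constructor
  · intro h G _ _ _ _ _ _ hG r sch T hW hYM hNT hNG
    obtain ⟨ℓ, hℓ, n, ε, hn, -, hεM, hev⟩ := h G hG r sch T hW hYM hNT hNG
    refine ⟨ℓ, hℓ, n, hn, ?_⟩
    have hM := shellCount_pos n
    have h1 : limsup (fun k : ℕ => influence r.ρ (sch.β k) ⌈ℓ / sch.a k⌉₊ n) atTop ≤ ε :=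
      limsup_le_of_le (isBoundedUnder_ge_influence r.ρ sch.β _ n).isCoboundedUnder_le hev
    have h2 : ε < 1 / ((((4 * n + 3) ^ 4 - (4 * n + 1) ^ 4 : ℕ)) : ℝ) := by
      rw [lt_div_iff₀ hM]; exact hεM
    exact h1.trans_lt h2
  · intro h G _ _ _ _ _ _ hG r sch T hW hYM hNT hNG
    obtain ⟨ℓ, hℓ, n, hn, hlt⟩ := h G hG r sch T hW hYM hNT hNG
    have hM := shellCount_pos n
    set M : ℝ := ((((4 * n + 3) ^ 4 - (4 * n + 1) ^ 4 : ℕ)) : ℝ) with hMdef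
    set L : ℝ := limsup (fun k : ℕ => influence r.ρ (sch.β k) ⌈ℓ / sch.a k⌉₊ n) atTop with hLdef
    set ε : ℝ := max 0 ((L + 1 / M) / 2) with hεdef
    have hLε : L < ε := by
      have : L < (L + 1 / M) / 2 := by linarith
      exact this.trans_le (le_max_right _ _)
    have hεM : ε * M < 1 := by
      rcases le_total 0 ((L + 1 / M) / 2) with h0 | h0
      · rw [hεdef, max_eq_right h0]
        have hL1 : L * M < 1 := by rwa [lt_div_iff₀ hM] at hlt
        have : (L + 1 / M) / 2 * M = (L * M + 1) / 2 := by field_simp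
        rw [this]; linarith
      · rw [hεdef, max_eq_left h0]; simp
    refine ⟨ℓ, hℓ, n, ε, hn, le_max_left _ _, hεM, ?_⟩
    have hev : ∀ᶠ k : ℕ in atTop, influence r.ρ (sch.β k) ⌈ℓ / sch.a k⌉₊ n < ε :=
      eventually_lt_of_limsup_lt hLε (isBoundedUnder_le_influence r.ρ sch.β _ n)
    filter_upwards [hev] with k hk using hk.le

/-- **The value leg is a `liminf` statement**: `stub_limitCertificate`'s statement says that along every admissible
scheme there is
one physical scale `(ℓ, n)` with `liminf_k Θ(r.ρ, β_k, ⌈ℓ/a_k⌉₊, n) < 1/M(n)` — the crux with `limsup` replaced by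
`liminf` of the same `[0,2]`-valued sequence; the UV leg (`stub_influenceConverges`) is exactly what identifies the two.
[folklore] -/
theorem limitCertificate_iff_liminf :
    (∀ (G : Type) [Group G] [TopologicalSpace G] [IsTopologicalGroup G] [CompactSpace G] [MeasurableSpace G]
        [BorelSpace G], IsCompactSimpleLieGroup G → ∀ (r : LatticeRep G) (sch : SpeciesScheme (YMSpecies G))
        (T : OSData (YMSpecies G) 4), sch.HasWeakCouplingLimit → IsYangMillsFor r sch T →
        T.IsNontrivial r.curvature → T.IsNonGaussian r.curvature →
        ∃ ℓ : ℝ, 0 < ℓ ∧ ∃ (n : ℕ) (θ : ℝ), 1 ≤ n ∧ θ * ((((4 * n + 3) ^ 4 - (4 * n + 1) ^ 4 : ℕ)) : ℝ) < 1 ∧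
          ∃ᶠ k : ℕ in atTop, influence r.ρ (sch.β k) ⌈ℓ / sch.a k⌉₊ n ≤ θ) ↔
      ∀ (G : Type) [Group G] [TopologicalSpace G] [IsTopologicalGroup G] [CompactSpace G] [MeasurableSpace G]
        [BorelSpace G], IsCompactSimpleLieGroup G → ∀ (r : LatticeRep G) (sch : SpeciesScheme (YMSpecies G))
        (T : OSData (YMSpecies G) 4), sch.HasWeakCouplingLimit → IsYangMillsFor r sch T →
        T.IsNontrivial r.curvature → T.IsNonGaussian r.curvature →
        ∃ ℓ : ℝ, 0 < ℓ ∧ ∃ n : ℕ, 1 ≤ n ∧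
          liminf (fun k : ℕ => influence r.ρ (sch.β k) ⌈ℓ / sch.a k⌉₊ n) atTop <
            1 / ((((4 * n + 3) ^ 4 - (4 * n + 1) ^ 4 : ℕ)) : ℝ) := by
  constructor
  · intro h G _ _ _ _ _ _ hG r sch T hW hYM hNT hNG
    obtain ⟨ℓ, hℓ, n, θ, hn, hθM, hfreq⟩ := h G hG r sch T hW hYM hNT hNG
    refine ⟨ℓ, hℓ, n, hn, ?_⟩
    have hM := shellCount_pos n
    have h1 : liminf (fun k : ℕ => influence r.ρ (sch.β k) ⌈ℓ / sch.a k⌉₊ n) atTop ≤ θ :=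
      liminf_le_of_frequently_le hfreq (isBoundedUnder_ge_influence r.ρ sch.β _ n)
    have h2 : θ < 1 / ((((4 * n + 3) ^ 4 - (4 * n + 1) ^ 4 : ℕ)) : ℝ) := by
      rw [lt_div_iff₀ hM]; exact hθM
    exact h1.trans_lt h2
  · intro h G _ _ _ _ _ _ hG r sch T hW hYM hNT hNG
    obtain ⟨ℓ, hℓ, n, hn, hlt⟩ := h G hG r sch T hW hYM hNT hNG
    have hM := shellCount_pos n
    set M : ℝ := ((((4 * n + 3) ^ 4 - (4 * n + 1) ^ 4 : ℕ)) : ℝ) with hMdef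
    set L : ℝ := liminf (fun k : ℕ => influence r.ρ (sch.β k) ⌈ℓ / sch.a k⌉₊ n) atTop with hLdef
    set θ : ℝ := (L + 1 / M) / 2 with hθdef
    have hLθ : L < θ := by rw [hθdef]; linarith
    have hθM : θ * M < 1 := by
      have hL1 : L * M < 1 := by rwa [lt_div_iff₀ hM] at hlt
      have : (L + 1 / M) / 2 * M = (L * M + 1) / 2 := by field_simp
      rw [hθdef, this]; linarith
    refine ⟨ℓ, hℓ, n, θ, hn, hθM, ?_⟩
    have hfr : ∃ᶠ k : ℕ in atTop, influence r.ρ (sch.β k) ⌈ℓ / sch.a k⌉₊ n < θ :=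
      frequently_lt_of_liminf_lt (isBoundedUnder_le_influence r.ρ sch.β _ n).isCoboundedUnder_ge hLθ
    exact hfr.mono fun k hk => hk.le

/-- Under the UV leg the two legs coincide scale by scale: if `Θ_k(ℓ, n)` converges, its `liminf` and `limsup`
agree, so the value leg's clause at `(ℓ, n)` is the crux's clause at `(ℓ, n)`. [folklore] -/
theorem liminf_eq_limsup_of_tendsto_influence {N : ℕ} (ρ : G →* Matrix (Fin N) (Fin N) ℂ) (βs : ℕ → ℝ)
    (bs : ℕ → ℕ) (n : ℕ) {θ : ℝ}
    (hlim : Tendsto (fun k : ℕ => influence (G := G) ρ (βs k) (bs k) n) atTop (𝓝 θ)) :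
    liminf (fun k : ℕ => influence (G := G) ρ (βs k) (bs k) n) atTop =
      limsup (fun k : ℕ => influence (G := G) ρ (βs k) (bs k) n) atTop := by
  rw [hlim.liminf_eq, hlim.limsup_eq]

end Summit.QuantumFields.YangMills.Cruxes.CrossoverCertificate.Birth

end
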